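import Literature.Computability.Cryptography.StatisticalDistanceMixtures
import HarnessLib

/-!
# Expectations of bounded functions under `PMF.bind`, `PMF.map` and conditional laws

Topic `Probability/Distributions`; theorems only. Real-valued expectations `E_p[f] = ∑' x, p(x) · f(x)`
of BOUNDED functions under compound laws — the bookkeeping by which per-condition estimates
("conditioned on any fixed `C`, `A`, `z` …", Micciancio–Regev 2007, proofs of Thm. 5.9 and Thm. 5.23,
eqs. (16)–(18)) pass to the mixture, and by which the law of an output conditioned on success is read
off the law with aborts:

* `PMF.summable_toReal_mul_of_bounded` — `x ↦ p(x) f(x)` is summable for `|f| ≤ M`;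
  `PMF.abs_tsum_toReal_mul_le` — `|E_p[f]| ≤ M`;
* `PMF.toReal_bind_apply` — `(p ≫= κ)(b) = ∑' a, p(a) κ_a(b)` in `ℝ`;
* `PMF.tsum_toReal_bind_mul` — **Fubini for a compound law**:
  `E_{p ≫= κ}[f] = ∑' a, p(a) · E_{κ a}[f]` for bounded `f`;
* `PMF.tsum_toReal_map_mul` — `E_{p.map g}[f] = E_p[f ∘ g]`;
* `PMF.tsum_toReal_bind_mul_le_of_forall` — **a mixture is bounded by the worst component on the
  support**: if `E_{κ a}[f] ≤ c` for all `a ∈ supp p` then `E_{p ≫= κ}[f] ≤ c`;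
* `PMF.tsum_toReal_cond_eq` — for a law `P` on `Option β` and its conditional law `q` given success
  (`P(some b) = (1 − P none) · q b`, cf. `FirstSuccessBlocks.exists_cond_law`):
  `E_q[f] = E_P[b ↦ f b on some b] / (1 − P none)`.

## References

* W. Feller, *An Introduction to Probability Theory and Its Applications I*, 3rd ed., Wiley 1968,
  Ch. IX §2 (expectations; conditional expectations as weighted averages) [folklore].
-/

noncomputable section

open scoped ENNReal

namespace PMF

variable {α β : Type*}

/-- `x ↦ p(x) · f(x)` is summable for a bounded `f`. [folklore] -/
theorem summable_toReal_mul_of_bounded (p : PMF α) {f : α → ℝ} {M : ℝ} (hf : ∀ x, |f x| ≤ M) :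
    Summable fun x => (p x).toReal * f x := by
  refine ((summable_coe_toReal p).mul_right M).of_norm_bounded (fun x => ?_)
  rw [Real.norm_eq_abs, abs_mul, abs_of_nonneg ENNReal.toReal_nonneg]
  exact mul_le_mul_of_nonneg_left (hf x) ENNReal.toReal_nonneg

/-- `|E_p[f]| ≤ M` for `|f| ≤ M`. [folklore] -/
theorem abs_tsum_toReal_mul_le (p : PMF α) {f : α → ℝ} {M : ℝ} (hf : ∀ x, |f x| ≤ M) :
    |∑' x, (p x).toReal * f x| ≤ M := by
  have hs := summable_toReal_mul_of_bounded p hf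
  refine (norm_tsum_le_tsum_norm hs.norm).trans ?_
  simp only [Real.norm_eq_abs]
  calc ∑' x, |(p x).toReal * f x| ≤ ∑' x, (p x).toReal * M := by
        refine hs.norm.tsum_le_tsum (fun x => ?_) ((summable_coe_toReal p).mul_right M)
        change |(p x).toReal * f x| ≤ _
        rw [abs_mul, abs_of_nonneg ENNReal.toReal_nonneg]
        exact mul_le_mul_of_nonneg_left (hf x) ENNReal.toReal_nonneg
    _ = M := by rw [tsum_mul_right, tsum_coe_toReal, one_mul]

/-- The point masses of a compound law, in `ℝ`: `(p ≫= κ)(b) = ∑' a, p(a) κ_a(b)`. [folklore] -/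
theorem toReal_bind_apply (p : PMF α) (κ : α → PMF β) (b : β) :
    ((p.bind κ) b).toReal = ∑' a, (p a).toReal * ((κ a) b).toReal := by
  rw [PMF.bind_apply, ENNReal.tsum_toReal_eq fun a =>
    ENNReal.mul_ne_top (p.apply_ne_top a) ((κ a).apply_ne_top b)]
  exact tsum_congr fun a => ENNReal.toReal_mul

/-- The joint masses `(a, b) ↦ p(a) κ_a(b)` are summable (total mass `1`). [folklore] -/
theorem summable_toReal_mul_toReal (p : PMF α) (κ : α → PMF β) :
    Summable fun ab : α × β => (p ab.1).toReal * ((κ ab.1) ab.2).toReal := by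
  have h : ∑' ab : α × β, p ab.1 * (κ ab.1) ab.2 ≠ ∞ := by
    rw [ENNReal.tsum_prod']
    have : ∑' a, ∑' b, p a * (κ a) b = 1 := by
      simp_rw [ENNReal.tsum_mul_left, PMF.tsum_coe, mul_one, PMF.tsum_coe]
    rw [this]; exact ENNReal.one_ne_top
  have hs := ENNReal.summable_toReal h
  refine hs.congr fun ab => ?_
  exact ENNReal.toReal_mul

/-- **Fubini for a compound law** (bounded integrand): `E_{p ≫= κ}[f] = ∑' a, p(a) · E_{κ a}[f]`.
[folklore] -/
theorem tsum_toReal_bind_mul (p : PMF α) (κ : α → PMF β) {f : β → ℝ} {M : ℝ} (hf : ∀ x, |f x| ≤ M) :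
    ∑' b, ((p.bind κ) b).toReal * f b = ∑' a, (p a).toReal * ∑' b, ((κ a) b).toReal * f b := by
  set F : α → β → ℝ := fun a b => (p a).toReal * (((κ a) b).toReal * f b) with hF
  have lhs : ∀ b, ((p.bind κ) b).toReal * f b = ∑' a, F a b := fun b => by
    rw [toReal_bind_apply, ← tsum_mul_right]
    exact tsum_congr fun a => by rw [hF, mul_assoc]
  have rhs : ∀ a, (p a).toReal * ∑' b, ((κ a) b).toReal * f b = ∑' b, F a b := fun a => by
    rw [← tsum_mul_left]
  simp_rw [lhs, rhs]
  -- absolute summability on `α × β`, and of the sections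
  have hunc : Summable (Function.uncurry F) := by
    refine ((summable_toReal_mul_toReal p κ).mul_left M).of_norm_bounded fun ab => ?_
    obtain ⟨a, b⟩ := ab
    simp only [Function.uncurry_apply_pair, hF, Real.norm_eq_abs]
    rw [abs_mul, abs_mul, abs_of_nonneg ENNReal.toReal_nonneg, abs_of_nonneg ENNReal.toReal_nonneg]
    calc (p a).toReal * (((κ a) b).toReal * |f b|) ≤ (p a).toReal * (((κ a) b).toReal * M) := by
          gcongr; exact hf b
      _ = M * ((p a).toReal * ((κ a) b).toReal) := by ring
  have h1 : ∀ a, Summable (F a) := fun a => (summable_toReal_mul_of_bounded (κ a) hf).mul_left _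
  have h2 : ∀ b, Summable fun a => F a b := fun b => by
    refine ((summable_coe_toReal p).mul_right (|f b|)).of_norm_bounded fun a => ?_
    simp only [hF, Real.norm_eq_abs]
    rw [abs_mul, abs_mul, abs_of_nonneg ENNReal.toReal_nonneg, abs_of_nonneg ENNReal.toReal_nonneg]
    have h1 : ((κ a) b).toReal ≤ 1 := by
      have := ENNReal.toReal_mono ENNReal.one_ne_top ((κ a).coe_le_one b)
      rwa [ENNReal.toReal_one] at this
    calc (p a).toReal * (((κ a) b).toReal * |f b|) ≤ (p a).toReal * (1 * |f b|) := by
          gcongr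
      _ = (p a).toReal * |f b| := by rw [one_mul]
  exact hunc.tsum_comm' h1 h2

/-- **Expectation under a push-forward**: `E_{p.map g}[f] = E_p[f ∘ g]` for bounded `f`. [folklore] -/
theorem tsum_toReal_map_mul (p : PMF α) (g : α → β) {f : β → ℝ} {M : ℝ} (hf : ∀ x, |f x| ≤ M) :
    ∑' b, ((p.map g) b).toReal * f b = ∑' a, (p a).toReal * f (g a) := by
  classical
  rw [← PMF.bind_pure_comp, tsum_toReal_bind_mul p _ hf]
  refine tsum_congr fun a => ?_
  congr 1
  rw [Function.comp_apply, tsum_eq_single (g a)]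
  · rw [PMF.pure_apply, if_pos rfl, ENNReal.toReal_one, one_mul]
  · intro b hb
    rw [PMF.pure_apply, if_neg hb, ENNReal.toReal_zero, zero_mul]

/-- **A mixture is bounded by its worst component on the support**: if `E_{κ a}[f] ≤ c` for every
`a ∈ supp p` (bounded `f`), then `E_{p ≫= κ}[f] ≤ c`. [folklore] -/
theorem tsum_toReal_bind_mul_le_of_forall (p : PMF α) (κ : α → PMF β) {f : β → ℝ} {M : ℝ}
    (hf : ∀ x, |f x| ≤ M) {c : ℝ}
    (hc : ∀ a ∈ p.support, ∑' b, ((κ a) b).toReal * f b ≤ c) :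
    ∑' b, ((p.bind κ) b).toReal * f b ≤ c := by
  rw [tsum_toReal_bind_mul p κ hf]
  have hE : ∀ a, |∑' b, ((κ a) b).toReal * f b| ≤ M := fun a => abs_tsum_toReal_mul_le (κ a) hf
  have hs : Summable fun a => (p a).toReal * ∑' b, ((κ a) b).toReal * f b :=
    summable_toReal_mul_of_bounded p hE
  calc ∑' a, (p a).toReal * ∑' b, ((κ a) b).toReal * f b ≤ ∑' a, (p a).toReal * c := by
        refine hs.tsum_le_tsum (fun a => ?_) ((summable_coe_toReal p).mul_right c)
        by_cases ha : a ∈ p.support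
        · exact mul_le_mul_of_nonneg_left (hc a ha) ENNReal.toReal_nonneg
        · rw [(PMF.apply_eq_zero_iff p a).2 ha, ENNReal.toReal_zero, zero_mul, zero_mul]
    _ = c := by rw [tsum_mul_right, tsum_coe_toReal, one_mul]

/-- **Expectation under the conditional law given success.** If `P` is a law on `Option β` with
`P none ≠ 1` and `q` its conditional law on successes (`P(some b) = (1 − P none) q b`), then
`E_q[f] = (1 − P none)⁻¹ · ∑' b, P(some b) f b` for bounded `f`. [folklore] -/
theorem tsum_toReal_cond_eq {P : PMF (Option β)} {q : PMF β} (hq : ∀ b, P (some b) = (1 - P none) * q b)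
    (hρ : P none ≠ 1) (f : β → ℝ) :
    ∑' b, (q b).toReal * f b = (1 - (P none).toReal)⁻¹ * ∑' b, (P (some b)).toReal * f b := by
  have h1 : (1 - P none).toReal = 1 - (P none).toReal := by
    rw [ENNReal.toReal_sub_of_le (P.coe_le_one _) ENNReal.one_ne_top, ENNReal.toReal_one]
  have hlt : (P none).toReal < 1 := by
    have h : P none < 1 := lt_of_le_of_ne (P.coe_le_one _) hρ
    have := (ENNReal.toReal_lt_toReal (P.apply_ne_top _) ENNReal.one_ne_top).2 h
    rwa [ENNReal.toReal_one] at this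
  have hne : 1 - (P none).toReal ≠ 0 := by linarith
  simp_rw [hq, ENNReal.toReal_mul, h1, mul_assoc]
  rw [tsum_mul_left, ← mul_assoc, inv_mul_cancel₀ hne, one_mul]

end PMF

end
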